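import Summits.CriticalPhenomena.PercolationContinuityZ3.Theorems.PercNearOneGluingAdditiveGluingCovTransferCertCheck

/-!
# `NoHeavyLowerTail` (crux stmt-CriticalPhenomena-4575), the SHK3⁺/bern4 terminal-edge step: a generic THREE-copy certificate
# checker for signed cubic combinations of connectivity-event probabilities, and the Richards–Sahi `E₃` rows

Support file (certificate seat `prim-cert-2`; `--supports stmt-CriticalPhenomena-4575`).  Measure-free checker + soundness, the
list-driven generalisation of `…AdditiveGluingCovTransferCertCheck` (which hard-codes the covariance transfer (T)): for a list of
terms `(s_j, A_j, B_j, C_j)` (integer sign, three Boolean connectivity predicates) the cubic form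

  `Φ(w) = Σ_j s_j · μ(A_j) · μ(B_j) · μ(C_j)`,   `μ = prodBernoulli w`, `μ(P) = μ(connEvent P)`,

is nonnegative at EVERY weight vector as soon as all `4^m` three-copy fibre sums (`cubicCoef` of `…CovTransferCertAlgebra`) are
nonnegative ("Richards-comb positivity"), read off the base-`2^σ` digits of one Kronecker number (`checkC`, `checkC_sound`).
The Richards (2004) / Sahi (2008) third-order functional `E₃(A,B,C) = 2μ(ABC) + μ(A)μ(B)μ(C) − μ(A)μ(BC) − μ(B)μ(AC) − μ(C)μ(AB)`
is such a form (`e3Terms`, `e3_of_checkE3`); its instances on GROUP-SEPARATION events of five terminals (the 77 "E3GRP" rows that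
close the SHK3⁺ terminal-edge Bernstein step numerically, run/shared/lean/ttrl/bern4/SDP.md) are evaluated in
`…E3GroupSepLeFive`.  Nothing here asserts anything about the crux.
-/

namespace Summit.CriticalPhenomena.PercolationContinuityZ3.Theorems.E3GroupSepCert

open Finset MeasureTheory OneCutCert CovTransferCert
open scoped BigOperators
open Literature.Probability.Percolation Literature.Probability.LatticeModels

variable {n : ℕ}

/-! ## Signed cubic terms -/

/-- A cubic term: an integer coefficient and three connectivity predicates. [this work] -/
abbrev CTerm (n : ℕ) : Type := ℤ × (CRel n → Bool) × (CRel n → Bool) × (CRel n → Bool)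

/-- Probability of a connectivity event. [this work] -/
noncomputable def pr (w : Sym2 (Fin n) → unitInterval) (P : CRel n → Bool) : ℝ := (prodBernoulli w).real (connEvent P)

/-- The value of a list of cubic terms: `Σ_j s_j μ(A_j) μ(B_j) μ(C_j)`. [this work] -/
noncomputable def cval (w : Sym2 (Fin n) → unitInterval) (ts : List (CTerm n)) : ℝ :=
  (ts.map fun t => (t.1 : ℝ) * pr w t.2.1 * pr w t.2.2.1 * pr w t.2.2.2).sum

/-! ## The checker -/

/-- The certificate number `Σ_j s_j · K(A_j) K(B_j) K(C_j)` (base-4 positions, base `2^σ`) from reach tables `base`. [this work] -/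
def zC (base : List (List ℕ)) (n σ : ℕ) (ts : List (CTerm n)) : ℤ :=
  let m := mE n
  let K : (CRel n → Bool) → ℤ := fun P => (krN4 σ m (evTabRT base P) : ℤ)
  (ts.map fun t => t.1 * (K t.2.1 * K t.2.2.1 * K t.2.2.2)).sum

/-- Sum of the absolute coefficients. [this work] -/
def sabs (ts : List (CTerm n)) : ℕ := (ts.map fun t => t.1.natAbs).sum

/-- The three-copy certificate CHECK with reach tables `base` (must be `baseRT n`): coefficient bound `sabs · 8^m < 2^(σ-1)` and the
AND-mask digit test on `Z + offT`. [this work] -/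
def checkCW (base : List (List ℕ)) (n σ : ℕ) (ts : List (CTerm n)) : Bool :=
  let m := mE n
  let Z := zC base n σ ts + offT σ m
  decide (0 < σ) && decide (sabs ts * 8 ^ m < 2 ^ (σ - 1)) && decide (0 ≤ Z) &&
    decide ((Z.toNat &&& (offT σ m).toNat) = (offT σ m).toNat)

/-- The check with the canonical reach tables. [this work] -/
def checkC (n σ : ℕ) (ts : List (CTerm n)) : Bool := checkCW (baseRT n) n σ ts

/-- A `Fin`-indexed sum over the entries of a list is the sum of the mapped list. [folklore] -/
theorem sum_fin_eq_sum_map {α β : Type*} [AddCommMonoid β] (l : List α) (g : α → β) :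
    (∑ i : Fin l.length, g l[(i : ℕ)]) = (l.map g).sum := by
  rw [← List.sum_ofFn, List.ofFn_getElem_eq_map]

/-- `sabs` as a `Fin`-sum of casts. [this work] -/
theorem sabs_eq (ts : List (CTerm n)) : (sabs ts : ℤ) = ∑ j : Fin ts.length, |(ts[(j : ℕ)]).1| := by
  unfold sabs
  rw [sum_fin_eq_sum_map ts (fun t => |t.1|)]
  push_cast
  congr 1
  induction ts with
  | nil => simp
  | cons t ts ih => simp [List.map_cons, ih]

set_option maxHeartbeats 800000 in
/-- **Soundness of `checkC`**: the cubic form is nonnegative at every weight vector. [this work] -/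
theorem checkC_sound (σ : ℕ) (ts : List (CTerm n)) (h : checkC n σ ts = true) (w : Sym2 (Fin n) → unitInterval) :
    0 ≤ cval w ts := by
  unfold checkC checkCW at h
  simp only [Bool.and_eq_true, decide_eq_true_eq] at h
  obtain ⟨⟨⟨hσ, hbnd⟩, hZ⟩, hland⟩ := h
  set m := mE n with hm
  -- the Fin-indexed data
  let s : Fin ts.length → ℤ := fun j => (ts[(j : ℕ)]).1
  let X : Fin ts.length → (Fin m → Bool) → ℤ := fun j => tabT n (ts[(j : ℕ)]).2.1
  let Y : Fin ts.length → (Fin m → Bool) → ℤ := fun j => tabT n (ts[(j : ℕ)]).2.2.1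
  let Z3 : Fin ts.length → (Fin m → Bool) → ℤ := fun j => tabT n (ts[(j : ℕ)]).2.2.2
  have hoff : offT σ m = (maskN σ (4 ^ m) : ℤ) := by
    unfold offT
    rw [off_eq σ (4 ^ m) hσ, maskN_eq_sum σ hσ, Finset.mul_sum]
  rw [hoff] at hZ hland
  rw [Int.toNat_natCast] at hland
  have hK : ∀ P : CRel n → Bool, (krN4 σ m (evTab n P) : ℤ) = KR4 (2 ^ σ) (tabT n P) := fun P =>
    krN4_eq σ m _ (length_evTab P)
  have hZeq : zC (baseRT n) n σ ts = cubicZ (2 ^ σ) s X Y Z3 := by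
    unfold zC cubicZ
    dsimp only
    rw [← sum_fin_eq_sum_map ts]
    refine Finset.sum_congr rfl fun j _ => ?_
    rw [← evTab, ← evTab, ← evTab, hK, hK, hK]
  have hB : CoefBound3 s X Y Z3 (2 ^ (σ - 1)) := by
    intro k
    have h8 : ∀ j, |s j * pcoef3 (X j) (Y j) (Z3 j) k| ≤ |s j| * 8 ^ m := by
      intro j
      rw [abs_mul]
      exact mul_le_mul_of_nonneg_left (abs_pcoef3_le _ _ _ (abs_tabT_le _) (abs_tabT_le _) (abs_tabT_le _) k) (abs_nonneg _)
    have hsum : |cubicCoef s X Y Z3 k| ≤ (sabs ts : ℤ) * 8 ^ m := by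
      unfold cubicCoef
      rw [sabs_eq, Finset.sum_mul]
      exact (Finset.abs_sum_le_sum_abs _ _).trans (Finset.sum_le_sum fun j _ => h8 j)
    have hpow : (sabs ts : ℤ) * 8 ^ m < (2 : ℕ) ^ (σ - 1) := by exact_mod_cast hbnd
    exact lt_of_le_of_lt hsum hpow
  set N : ℕ := (zC (baseRT n) n σ ts + maskN σ (4 ^ m)).toNat with hN
  have hNZ : (N : ℤ) = cubicZ (2 ^ σ) s X Y Z3 + ∑ j : Fin (4 ^ m), (2 : ℤ) ^ (σ - 1) * (2 ^ σ) ^ (j : ℕ) := by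
    rw [hN, Int.toNat_of_nonneg hZ, hZeq, maskN_eq_sum σ hσ, Fin.sum_univ_eq_sum_range
      (fun j => (2 : ℤ) ^ (σ - 1) * (2 ^ σ) ^ j) (4 ^ m)]
  have hdig : ∀ j : ℕ, j < 4 ^ m → 2 ^ (σ - 1) ≤ digit (2 ^ σ) N j := digit_ge_of_land σ hσ (4 ^ m) N hland
  have hk : ∀ k, 0 ≤ cubicCoef s X Y Z3 k := cubicCoef_nonneg_of_digit_ge hσ hB N hNZ hdig
  have hF : 0 ≤ cubicForm s X Y Z3 (xOf w) := cubicForm_nonneg hk (inCube_xOf w)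
  unfold cubicForm at hF
  have hval : (∑ j : Fin ts.length, (s j : ℝ) * (ML (fun g => (X j g : ℝ)) (xOf w) * ML (fun g => (Y j g : ℝ)) (xOf w) *
      ML (fun g => (Z3 j g : ℝ)) (xOf w))) = cval w ts := by
    unfold cval pr
    rw [← sum_fin_eq_sum_map ts]
    refine Finset.sum_congr rfl fun j _ => ?_
    simp only [s, X, Y, Z3, real_connEvent_eq_ML]
    ring
  rw [hval] at hF
  exact hF

/-! ## The Richards–Sahi third-order functional -/

/-- The constant-true predicate (the sure event). [this work] -/
def pTrue : CRel n → Bool := fun _ => true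

/-- Conjunction of predicates (intersection of events). [this work] -/
def pAnd (P Q : CRel n → Bool) : CRel n → Bool := fun r => P r && Q r

/-- The sure event has probability one. [this work] -/
theorem pr_pTrue (w : Sym2 (Fin n) → unitInterval) : pr w (pTrue : CRel n → Bool) = 1 := by
  unfold pr
  have : connEvent (pTrue : CRel n → Bool) = Set.univ := by ext ω; simp [connEvent, pTrue]
  rw [this]
  simp

/-- Intersection of connectivity events. [this work] -/
theorem connEvent_pAnd (P Q : CRel n → Bool) : connEvent (pAnd P Q) = connEvent P ∩ connEvent Q := by
  ext ω; simp [connEvent, pAnd]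

/-- The five cubic terms of `E₃(A,B,C) = 2μ(ABC) + μ(A)μ(B)μ(C) − μ(A)μ(BC) − μ(B)μ(AC) − μ(C)μ(AB)`. [this work] -/
def e3Terms (A B C : CRel n → Bool) : List (CTerm n) :=
  [((2 : ℤ), pAnd A (pAnd B C), pTrue, pTrue), ((1 : ℤ), A, B, C), ((-1 : ℤ), A, pAnd B C, pTrue),
    ((-1 : ℤ), B, pAnd A C, pTrue), ((-1 : ℤ), C, pAnd A B, pTrue)]

/-- The Richards–Sahi inequality `E₃(A,B,C) ≥ 0` for three connectivity events, as an inequality between products of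
probabilities. [this work] -/
def E3Ineq (w : Sym2 (Fin n) → unitInterval) (A B C : CRel n → Bool) : Prop :=
  (prodBernoulli w).real (connEvent A) * (prodBernoulli w).real (connEvent B ∩ connEvent C) +
      (prodBernoulli w).real (connEvent B) * (prodBernoulli w).real (connEvent A ∩ connEvent C) +
      (prodBernoulli w).real (connEvent C) * (prodBernoulli w).real (connEvent A ∩ connEvent B) ≤
    2 * (prodBernoulli w).real (connEvent A ∩ connEvent B ∩ connEvent C) +
      (prodBernoulli w).real (connEvent A) * (prodBernoulli w).real (connEvent B) * (prodBernoulli w).real (connEvent C)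

/-- The check of the `E₃` terms. [this work] -/
def checkE3 (n σ : ℕ) (A B C : CRel n → Bool) : Bool := checkC n σ (e3Terms A B C)

/-- **`E₃ ≥ 0` from the check**, at every weight vector. [this work] -/
theorem e3_of_checkE3 {σ : ℕ} {A B C : CRel n → Bool} (h : checkE3 n σ A B C = true) (w : Sym2 (Fin n) → unitInterval) :
    E3Ineq w A B C := by
  have hv := checkC_sound σ _ h w
  unfold cval e3Terms at hv
  simp only [List.map_cons, List.map_nil, List.sum_cons, List.sum_nil, pr_pTrue] at hv
  unfold pr at hv
  simp only [connEvent_pAnd] at hv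
  rw [← Set.inter_assoc] at hv
  unfold E3Ineq
  push_cast at hv
  linarith

/-- The check for a list of predicate triples, sharing the reach tables. [this work] -/
def checkE3List (n σ : ℕ) (l : List ((CRel n → Bool) × (CRel n → Bool) × (CRel n → Bool))) : Bool :=
  let base := baseRT n
  l.all fun t => checkCW base n σ (e3Terms t.1 t.2.1 t.2.2)

/-- `checkE3List` certifies each listed triple. [this work] -/
theorem checkE3_of_checkE3List {σ : ℕ} {l : List ((CRel n → Bool) × (CRel n → Bool) × (CRel n → Bool))}
    (h : checkE3List n σ l = true) {A B C : CRel n → Bool} (ht : (A, B, C) ∈ l) : checkE3 n σ A B C = true := by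
  have h' : ∀ t ∈ l, checkCW (baseRT n) n σ (e3Terms t.1 t.2.1 t.2.2) = true := by
    simpa only [checkE3List, List.all_eq_true] using h
  exact h' (A, B, C) ht

end Summit.CriticalPhenomena.PercolationContinuityZ3.Theorems.E3GroupSepCert
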